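import Summits.Ventures.GridStability.Bench.NE39SPEnergyRate
import Summits.Ventures.GridStability.Lyapunov.StructurePreservingRateDiamRoa
import HarnessLib

/-!
# GridStability/Bench/NE39SPEnergyRateDiam — «SP-RATE» on rung «G2.b-SP NE39» with the DIAMETER
# constant: the BFS tree of model-2's instance file has depth 11, so every two of the 49 nodes are joined
# by a walk of length ≤ 22 and the leaf-Poincaré constant drops from `4·49² = 9604` to `4·22 = 88`

Cell `gridfusion` (LADDER-GRIDFUSION), seat gridfusion-lyap-1 (g7), brief «SP-RATE»; the lever of lead g8's
memo §3 note (fold #39: «the leaf-Poincaré walk constant n² is the SP-rate ceiling») applied to the NE39-SP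
instance of record. INPUTS BY NAME: `Bench/NE39SPEnergyRate.lean` (`sum_gen_M`, `half_le_sectorGain`),
model-2's `Models/NE39SP.lean` (`parentV`, `depthV`, `treeEdge`, `srcV`, `tgtV`, `wt_pos`: the BFS spanning
tree from G1 = node 39), this seat's `Lyapunov/StructurePreservingRateDiam{,Roa}.lean` (`vhRateD`, `vhGainD`,
`phaseEnergy_le_mul_exp_neg_of_sublevel_diam`, `exists_walk_length_le_of_parent`).

WHAT IS PROVED (kernel; `decide` over the 49-entry tables):
* `diam_le` — every two nodes of the NE39-SP coupling graph are joined by a walk of length `≤ 22`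
  (parent adjacency from the listed tree edges, `depthV (parentV v) < depthV v`, `depthV v ≤ 11`);
* `energy_le_mul_exp_neg_diam` — for EVERY `D > 0` and `0 < h` with `2h·Mᵢ ≤ Dᵢ` on the internal nodes,
  along EVERY global solution from the certified region of record `{V ≤ 29/10} ∩ window ∩ leaf`:
  `V(X t) ≤ 3·vhGainD·V(X 0)·exp(−vhRateD·t)` with `d = 22`;
* `vhRateD_ge` — **`vhRateD ≥ min{ h/(1 + (7827/1885)·h/ΣD), h/(1 + 88·h·ΣD/β) }`**
  (`β = 5200202273/312500000`; compare `9604` in `NE39SPEnergyRate.vhRate_ge`: the binding branch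
  improves by the factor `9604/88 ≈ 109`); `vhGainD_le`; `energy_le_mul_exp_neg_diam_explicit`.

THREE COLUMNS. CERTIFIED (kernel, here): the inequalities above for MODEL M′ = MV-3 at the NE39-SP data
of record (column LF), every `D > 0`. MODELLED: model-2's tokens («… D(∀) …»). HONEST NUMBER
(VALIDATED-type commentary): for an illustrative uniform `Dᵢ = d` the bound is now `≈ 3.9·10⁻³/d s⁻¹`
(time constant `≈ 4·d` minutes) instead of `3.6·10⁻⁵/d s⁻¹` — still a LOWER bound on the model's rate
driven by a graph constant, not a damping figure; the remaining lever is a spectral (Laplacian) constant,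
which is certificate work, not closed form. No sentence of this file says that the New England system or
any grid is stable or well damped. No definition, no named fact; standard axioms.
-/

noncomputable section

open Set Filter Topology Real Finset
open Summit.Ventures.GridStability.Models
open Summit.Ventures.GridStability.Models.StructurePreserving
open Summit.Ventures.GridStability.Models.NE39SP
open Summit.Ventures.GridStability.Lyapunov.StructurePreserving (vhRateD vhGainD vhRateD_pos
  two_le_vhGainD phaseEnergy_le_mul_exp_neg_of_sublevel_diam exists_walk_length_le_of_parent)

namespace Summit.Ventures.GridStability.Bench.NE39SP

/-! ### The diameter bound from the BFS tree -/

/-- **Every two nodes of the NE39-SP coupling graph are joined by a walk of length `≤ 22`**: the BFS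
parent array of model-2's file is a spanning structure of depth `11` (49 `decide` checks for the tree
edges, 49 for the depth decrease, 49 for the depth bound). CERTIFIED. [folklore] -/
theorem diam_le (D : Fin 49 → ℝ) :
    ∀ i j : Fin 49, ∃ w : (params D).couplingGraph.Walk i j, w.length ≤ 2 * 11 := by
  have hne : ∀ v : Fin 49, v ≠ 39 → parentV v ≠ v :=
    fun v hv => (by decide : ∀ v : Fin 49, v ≠ 39 → parentV v ≠ v) v hv
  have hb' : ∀ v : Fin 49, v ≠ 39 → (params D).b (parentV v) v ≠ 0 := by
    intro v hv
    rw [params_b]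
    refine symmetrize_edgeWeight_ne_zero_of_edge wt_nonneg (treeEdge v) (wt_pos _) ?_
    exact (by decide : ∀ v : Fin 49, v ≠ 39 →
      (srcV (treeEdge v) = parentV v ∧ tgtV (treeEdge v) = v)
        ∨ (srcV (treeEdge v) = v ∧ tgtV (treeEdge v) = parentV v)) v hv
  have hadj : ∀ v : Fin 49, v ≠ 39 → (params D).couplingGraph.Adj v (parentV v) := fun v hv =>
    (((params D).couplingGraph_adj_of_symm b_symm (parentV v) v).2 ⟨hne v hv, hb' v hv⟩).symm
  have hdepth : ∀ v : Fin 49, v ≠ 39 → depthV (parentV v) < depthV v :=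
    fun v hv => (by decide : ∀ v : Fin 49, v ≠ 39 → depthV (parentV v) < depthV v) v hv
  have he : ∀ v : Fin 49, depthV v ≤ 11 := by decide
  exact exists_walk_length_le_of_parent 39 parentV depthV hadj hdepth he

/-! ### The rate theorem with the diameter constant -/

/-- **«SP-RATE» on rung «G2.b-SP NE39» with the diameter constant (`d = 22`).** MODEL MV-3 at the NE39-SP
instance of record (column LF), for EVERY `D > 0` and every `0 < h` with `2h·Mᵢ ≤ Dᵢ` on the internal
nodes: along EVERY global solution `X` of the structure-preserving field from
`S = {V(δ₀; δ, ω) ≤ 29/10} ∩ window ∩ {L = L(δ₀, 0), ω_bus = 0}`, for all `t ≥ 0`: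
`V(X t) ≤ 3·vhGainD·V(X 0)·exp(−vhRateD·t)` (`d = 22`). CERTIFIED for MODEL M′ only; no sentence here says
a grid is stable or well damped. [cite: Khalil2002, Theorem 4.10]; [cite: Padiyar2013, App. D] -/
theorem energy_le_mul_exp_neg_diam {D : Fin 49 → ℝ} (hD : ∀ i, 0 < D i) {h : ℝ} (hh : 0 < h)
    (hhM : ∀ i ∈ genS, 2 * h * (MQ i : ℝ) ≤ D i)
    {X : ℝ → (Fin 49 → ℝ) × (Fin 49 → ℝ)}
    (hX0 : X 0 ∈ (params D).window ∩ (params D).constraintSet δ₀ ∧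
      (params D).energy δ₀ (X 0).1 (X 0).2 ≤ 29 / 10)
    (hX : ∀ T : ℝ, ∀ s ∈ Icc 0 T,
      HasDerivWithinAt X ((params D).shifted.phaseField (X s)) (Icc 0 T) s)
    {t : ℝ} (ht : 0 ≤ t) :
    (params D).energy δ₀ (X t).1 (X t).2
      ≤ 3 * vhGainD (params D) (betaLF : ℝ) θ h (2 * 11) * (params D).energy δ₀ (X 0).1 (X 0).2
        * Real.exp (-vhRateD (params D) (betaLF : ℝ) θ h (2 * 11) * t) := by
  have hhM' : ∀ i ∈ (params D).gen, 2 * h * (params D).M i ≤ (params D).D i := hhM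
  have hX0' : X 0 ∈ Lyapunov.StructurePreserving.window (params D)
      ∩ Lyapunov.StructurePreserving.constraintSet (params D) δ₀ ∧
      Lyapunov.StructurePreserving.phaseEnergy (params D) δ₀ (X 0) ≤ 29 / 10 := by
    rw [(params D).lyapunov_window_eq, (params D).lyapunov_constraintSet_eq]
    exact hX0
  have hX' : ∀ T : ℝ, ∀ s ∈ Icc 0 T, HasDerivWithinAt X
      (Lyapunov.StructurePreserving.phaseField (params D) (X s)) (Icc 0 T) s := by
    rw [(params D).lyapunov_phaseField_eq]
    exact hX
  exact phaseEnergy_le_mul_exp_neg_of_sublevel_diam (wellFormed hD) (by decide) (preconnected D)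
    (fun i j => by rw [params_b]; exact b_nonneg i j) beta_pos (edge_lower D) (diam_le D)
    theta_nonneg theta_lt_pi_div_two (window D) (isSyncEquilibrium D) level_lt_levelBound hh hhM'
    hX0' hX' ht

/-! ### The explicit rational bounds in `(ΣD, h)` with the constant `88` -/

/-- **Explicit lower bound of the diameter rate**: for every `D > 0` and `h > 0`,
`vhRateD ≥ min{ h/(1 + (7827/1885)·h/ΣD), h/(1 + 88·h·ΣD/β) }` (`4·d = 88`, `2·g(θ) ≥ 1`). CERTIFIED.
[folklore] -/
theorem vhRateD_ge {D : Fin 49 → ℝ} (hD : ∀ i, 0 < D i) {h : ℝ} (hh : 0 < h) :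
    min (h / (1 + (7827 / 1885) * h / ∑ i, D i)) (h / (1 + 88 * h * (∑ i, D i) / (betaLF : ℝ)))
      ≤ vhRateD (params D) (betaLF : ℝ) θ h (2 * 11) := by
  have hSD : 0 < ∑ i, D i := Finset.sum_pos (fun i _ => hD i) Finset.univ_nonempty
  have hβ : (0 : ℝ) < (betaLF : ℝ) := beta_pos
  have hg := half_le_sectorGain
  unfold vhRateD
  rw [sum_gen_M D]
  change min _ _ ≤ min (h / (1 + h * (7827 / 1885) / ∑ i, D i))
    (2 * h * ((1 - Real.sin θ) / (π / 2 - θ))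
      / (1 + 4 * h * ((2 * 11 : ℕ) : ℝ) * (∑ i, D i) / betaLF))
  refine min_le_min (le_of_eq ?_) ?_
  · ring_nf
  · have hden : 0 < 1 + 88 * h * (∑ i, D i) / (betaLF : ℝ) := by positivity
    have hdeq : (1 + 4 * h * ((2 * 11 : ℕ) : ℝ) * (∑ i, D i) / (betaLF : ℝ))
        = 1 + 88 * h * (∑ i, D i) / (betaLF : ℝ) := by
      push_cast
      ring
    rw [hdeq]
    exact div_le_div_of_nonneg_right (by nlinarith) hden.le

/-- **Explicit upper bound of the diameter gain**: `vhGainD ≤ max{2 + 2·(7827/1885)·h/ΣD, 2·(1 + 88·h·ΣD/β)}`.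
CERTIFIED. [folklore] -/
theorem vhGainD_le {D : Fin 49 → ℝ} (hD : ∀ i, 0 < D i) {h : ℝ} (hh : 0 < h) :
    vhGainD (params D) (betaLF : ℝ) θ h (2 * 11)
      ≤ max (2 + 2 * (7827 / 1885) * h / ∑ i, D i) (2 * (1 + 88 * h * (∑ i, D i) / (betaLF : ℝ))) := by
  have hSD : 0 < ∑ i, D i := Finset.sum_pos (fun i _ => hD i) Finset.univ_nonempty
  have hβ : (0 : ℝ) < (betaLF : ℝ) := beta_pos
  have hg := half_le_sectorGain
  have hgpos : 0 < (1 - Real.sin θ) / (π / 2 - θ) := lt_of_lt_of_le (by norm_num) hg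
  unfold vhGainD
  rw [sum_gen_M D]
  change max (2 + 2 * h * (7827 / 1885) / ∑ i, D i)
    ((1 + 4 * h * ((2 * 11 : ℕ) : ℝ) * (∑ i, D i) / betaLF) / ((1 - Real.sin θ) / (π / 2 - θ))) ≤ _
  refine max_le_max (le_of_eq ?_) ?_
  · ring_nf
  · have hdeq : (1 + 4 * h * ((2 * 11 : ℕ) : ℝ) * (∑ i, D i) / (betaLF : ℝ))
        = 1 + 88 * h * (∑ i, D i) / (betaLF : ℝ) := by
      push_cast
      ring
    rw [hdeq]
    have hA : 0 ≤ 1 + 88 * h * (∑ i, D i) / (betaLF : ℝ) := by positivity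
    rw [div_le_iff₀ hgpos]
    nlinarith

/-- **The «SP-RATE» sentence on «G2.b-SP NE39» with the diameter constant, explicit form.** For EVERY
`D > 0` and every `0 < h` with `2h·Mᵢ ≤ Dᵢ` on the internal nodes, along EVERY global solution `X` from
`S = {V ≤ 29/10} ∩ window ∩ leaf`, for all `t ≥ 0`:
`V(X t) ≤ 3·C(ΣD, h)·V(X 0)·exp(−ρ(ΣD, h)·t)` with `ρ = min{h/(1 + (7827/1885)h/ΣD), h/(1 + 88·h·ΣD/β)}`,
`C = max{2 + 2(7827/1885)h/ΣD, 2(1 + 88·h·ΣD/β)}`, `β = 5200202273/312500000`. CERTIFIED for MODEL M′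
= MV-3 at the data of record; a LOWER bound on the model's rate; no sentence here says a grid is stable or
well damped. [cite: Khalil2002, Theorem 4.10]; [cite: Padiyar2013, App. D] -/
theorem energy_le_mul_exp_neg_diam_explicit {D : Fin 49 → ℝ} (hD : ∀ i, 0 < D i) {h : ℝ}
    (hh : 0 < h) (hhM : ∀ i ∈ genS, 2 * h * (MQ i : ℝ) ≤ D i)
    {X : ℝ → (Fin 49 → ℝ) × (Fin 49 → ℝ)}
    (hX0 : X 0 ∈ (params D).window ∩ (params D).constraintSet δ₀ ∧
      (params D).energy δ₀ (X 0).1 (X 0).2 ≤ 29 / 10)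
    (hX : ∀ T : ℝ, ∀ s ∈ Icc 0 T,
      HasDerivWithinAt X ((params D).shifted.phaseField (X s)) (Icc 0 T) s)
    {t : ℝ} (ht : 0 ≤ t) :
    (params D).energy δ₀ (X t).1 (X t).2
      ≤ 3 * max (2 + 2 * (7827 / 1885) * h / ∑ i, D i) (2 * (1 + 88 * h * (∑ i, D i) / (betaLF : ℝ)))
        * (params D).energy δ₀ (X 0).1 (X 0).2
        * Real.exp (-min (h / (1 + (7827 / 1885) * h / ∑ i, D i))
            (h / (1 + 88 * h * (∑ i, D i) / (betaLF : ℝ))) * t) := by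
  have hmain := energy_le_mul_exp_neg_diam hD hh hhM hX0 hX ht
  have hρ := vhRateD_ge hD hh
  have hC := vhGainD_le hD hh
  have hV0 : 0 ≤ (params D).energy δ₀ (X 0).1 (X 0).2 := by
    have hw := hX0.1.1
    refine (params D).energy_nonneg (wellFormed hD) (fun i j => by rw [params_b]; exact b_nonneg i j)
      (fun i j hij => ((window D) i j hij).trans theta_lt_pi_div_two.le) ?_ _
    intro i j hij
    have h1 := abs_lt.1 (hw i j hij)
    have h2 := abs_le.1 (((window D) i j hij).trans theta_lt_pi_div_two.le)
    exact abs_le.2 ⟨by linarith [h1.1, h2.1], by linarith [h1.2, h2.2]⟩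
  have hexp : Real.exp (-vhRateD (params D) (betaLF : ℝ) θ h (2 * 11) * t)
      ≤ Real.exp (-min (h / (1 + (7827 / 1885) * h / ∑ i, D i))
            (h / (1 + 88 * h * (∑ i, D i) / (betaLF : ℝ))) * t) :=
    Real.exp_le_exp.2 (by nlinarith)
  have hexp0 : 0 ≤ Real.exp (-vhRateD (params D) (betaLF : ℝ) θ h (2 * 11) * t) := (Real.exp_pos _).le
  have hG0 : 0 ≤ vhGainD (params D) (betaLF : ℝ) θ h (2 * 11) :=
    le_trans (by norm_num) (two_le_vhGainD (wellFormed hD) (by decide) hh.le (2 * 11))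
  calc (params D).energy δ₀ (X t).1 (X t).2
      ≤ 3 * vhGainD (params D) (betaLF : ℝ) θ h (2 * 11) * (params D).energy δ₀ (X 0).1 (X 0).2
          * Real.exp (-vhRateD (params D) (betaLF : ℝ) θ h (2 * 11) * t) := hmain
    _ ≤ 3 * max (2 + 2 * (7827 / 1885) * h / ∑ i, D i)
            (2 * (1 + 88 * h * (∑ i, D i) / (betaLF : ℝ)))
          * (params D).energy δ₀ (X 0).1 (X 0).2
          * Real.exp (-vhRateD (params D) (betaLF : ℝ) θ h (2 * 11) * t) := by
        have := mul_le_mul_of_nonneg_right (mul_le_mul_of_nonneg_right hC hV0) hexp0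
        linarith
    _ ≤ 3 * max (2 + 2 * (7827 / 1885) * h / ∑ i, D i)
            (2 * (1 + 88 * h * (∑ i, D i) / (betaLF : ℝ)))
          * (params D).energy δ₀ (X 0).1 (X 0).2
          * Real.exp (-min (h / (1 + (7827 / 1885) * h / ∑ i, D i))
              (h / (1 + 88 * h * (∑ i, D i) / (betaLF : ℝ))) * t) := by
        have hpre : 0 ≤ 3 * max (2 + 2 * (7827 / 1885) * h / ∑ i, D i)
            (2 * (1 + 88 * h * (∑ i, D i) / (betaLF : ℝ)))
            * (params D).energy δ₀ (X 0).1 (X 0).2 :=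
          mul_nonneg (mul_nonneg (by norm_num) (le_trans hG0 hC)) hV0
        exact mul_le_mul_of_nonneg_left hexp hpre

end Summit.Ventures.GridStability.Bench.NE39SP

end
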